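import Summits.QuantumAdvantage.AdviceFreeQNC0.DominationCertificate
import Summits.QuantumAdvantage.AdviceFreeQNC0.SymmetricCodewords
import Summits.QuantumAdvantage.AdviceFreeQNC0.MassInequalityRegimes
import HarnessLib

/-!
# Cell qa-qnc0 (rung F-Q1, density axis): TRIANGULAR SHORT-WORD CERTIFICATES for `DualGenOut m K0 L`
# — the generic, table-driven checker (instances at `m = 8` in `DualGenOutEight*.lean`)

`DualGenOut m K0 L` (`MassInequalityRegimes.lean`, planner qa-qnc0-p1 Sketch13 v6c): the dual words of the
one-block code `C_m` supported outside `Z(K0)` lie in the span of those of length `≤ L`.  It is one of the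
two finite inputs of the near-outside mass inequality (`nearOutMass_of_isOpt1`, `NearOutCorollaries.lean`).

A CERTIFICATE (namespace `DualGenCert`) consists of
* an ORDERED list of words `g` (lists of point codes `n < 2^m`, decoded by `pt m n i = n.testBit i`),
  each with a PIVOT point `p ∈ g` that lies in NO LATER word of the list (`TriOK`, triangularity);
  every word is short (`≤ L` points, no duplicates), outside `Z(K0)`, and passes the GENERATOR CHECK
  (`GensOK`: it kills the `2(m+1)` generators `(x^S, 0)`, `(0, x^S)`, `#S ≤ 1`, of the linear pattern map
  `(T₀, T₁) ↦ A`, hence — `Submodule.span_induction` — has even overlap with EVERY codeword: `WordsOK`);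
* a list of NON-PIVOT outside points `q`, each with affine data `(ℓ0, ℓ1)` of a codeword `cwOf ℓ0 ℓ1`
  (`SymmetricCodewords.lean`) that SEPARATES it: `cwOf ℓ0 ℓ1 = δ_q` on the non-pivots (`SepOK`);
* the two lists together cover `Z(K0)ᶜ` (`CoverOK`).

`DualGenCert.dualGenOut_of_cert`: then `DualGenOut m K0 L`.  Proof: a dual word `r` supported outside `Z`
is reduced along the list (`elim`, induction: subtract `r(p)·g` at the head, the tail words do not touch
`p`) to a dual word `r'` vanishing at all pivots, i.e. supported on the non-pivots; pairing `r'` with the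
separating codeword of `q` gives `r'(q) = 0`; so `r` is the combination of the certificate words, each of
which is a short outside dual word.

WHAT THIS IS NOT: certificates exist here only where a short triangular basis was found (m = 8, both optima,
`DualGenOutEight*.lean`); nothing on the far regime / `MassIneqAll`; separation NOT moved.
-/

namespace Summit.QuantumAdvantage.AdviceFreeQNC0

open Finset
open Literature.Computability.MetaComplexity Literature.Computability.MetaComplexity.Smolensky

namespace MassInequality

namespace DualGenCert

variable {m : ℕ}

/-! ### Points, words, certificate checks -/

/-- Decoding of a point code: coordinate `i` is bit `i`. -/
def pt (m : ℕ) (n : ℕ) : Fin m → Bool := fun i => Nat.testBit n i.val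

/-- The decoded points of a word. -/
def pts (m : ℕ) (g : List ℕ) : List (Fin m → Bool) := g.map (pt m)

/-- The affine form with support mask `s` and constant `b`. -/
def aff (m : ℕ) (s : ℕ) (b : Bool) : Finset (Fin m) × Bool := (univ.filter fun i : Fin m => Nat.testBit s i.val, b)

/-- The word sum of the linear pattern of the pair `(p, q)` (`DomCert.patZ`) over a list of points. -/
def wsum (l : List (Fin m → Bool)) (p q : CubeFn (ZMod 2) m) : ZMod 2 := ∑ u ∈ l.toFinset, DomCert.patZ p q u

/-- GENERATOR CHECK for a word: it kills `(x^S, 0)` and `(0, x^S)` for `#S ≤ 1` (list sums, for `decide`). -/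
def GensOK (l : List (Fin m → Bool)) : Prop :=
  ∀ S ∈ (univ : Finset (Finset (Fin m))).filter (fun S => S.card ≤ 1),
    (l.map (DomCert.patZ (mono (ZMod 2) S) 0)).sum = 0 ∧ (l.map (DomCert.patZ 0 (mono (ZMod 2) S))).sum = 0

/-- CHECK 1 (words): every word is duplicate-free, short, outside `Z(K0)`, contains its pivot, and passes
the generator check. -/
def WordsOK (K0 : (Fin m → Bool) → Bool) (L : ℕ) (ws : List (List ℕ × ℕ)) : Prop :=
  ∀ e ∈ ws, (pts m e.1).Nodup ∧ (pts m e.1).length ≤ L ∧ (∀ u ∈ pts m e.1, K0 u = true) ∧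
    pt m e.2 ∈ pts m e.1 ∧ GensOK (pts m e.1)

/-- CHECK 2 (triangularity): the pivot of each word lies in no later word. -/
def triOK (m : ℕ) : List (List ℕ × ℕ) → Bool
  | [] => true
  | e :: t => (t.all fun e' => !decide (pt m e.2 ∈ pts m e'.1)) && triOK m t

/-- CHECK 3 (cover): every outside point is a pivot or a listed non-pivot. -/
def CoverOK (K0 : (Fin m → Bool) → Bool) (ws : List (List ℕ × ℕ)) (sep : List (ℕ × ℕ × Bool × ℕ × Bool)) : Prop :=
  ∀ u : Fin m → Bool, K0 u = true → u ∈ ws.map (fun e => pt m e.2) ∨ u ∈ sep.map (fun e => pt m e.1)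

/-- The separating codeword of a non-pivot entry `(q, s0, b0, s1, b1)`. -/
def sepWord (m : ℕ) (e : ℕ × ℕ × Bool × ℕ × Bool) : (Fin m → Bool) → Bool :=
  SymCount.cwOf (aff m e.2.1 e.2.2.1) (aff m e.2.2.2.1 e.2.2.2.2)

/-- CHECK 4 (separation): the codeword of `q` is `δ_q` on the non-pivots. -/
def SepOK (m : ℕ) (sep : List (ℕ × ℕ × Bool × ℕ × Bool)) : Prop :=
  ∀ e ∈ sep, ∀ e' ∈ sep, sepWord m e (pt m e'.1) = decide (pt m e'.1 = pt m e.1)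

/-! ### Words as vectors; the generator check gives duality -/

/-- The indicator vector of a word. -/
def vec (l : List (Fin m → Bool)) : (Fin m → Bool) → ZMod 2 := fun u => if u ∈ l then 1 else 0

/-- The indicator vector is `1` on the word … -/
theorem vec_of_mem {l : List (Fin m → Bool)} {u : Fin m → Bool} (h : u ∈ l) : vec l u = 1 := if_pos h

/-- … and `0` off it. -/
theorem vec_of_not_mem {l : List (Fin m → Bool)} {u : Fin m → Bool} (h : u ∉ l) : vec l u = 0 := if_neg h

/-- `WordsOK` is checked chunk by chunk. -/
theorem wordsOK_append {K0 : (Fin m → Bool) → Bool} {L : ℕ} {l₁ l₂ : List (List ℕ × ℕ)}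
    (h₁ : WordsOK K0 L l₁) (h₂ : WordsOK K0 L l₂) : WordsOK K0 L (l₁ ++ l₂) :=
  fun e he => (List.mem_append.1 he).elim (h₁ e) (h₂ e)

/-- `wsum` splits over the pair. -/
theorem wsum_split (l : List (Fin m → Bool)) (p q : CubeFn (ZMod 2) m) :
    wsum l p q = wsum l p 0 + wsum l 0 q := by
  unfold wsum
  have h : ∀ u, DomCert.patZ p q u = DomCert.patZ p 0 u + DomCert.patZ 0 q u := fun u => by
    unfold DomCert.patZ; split_ifs <;> simp
  rw [Finset.sum_congr rfl fun u _ => h u, sum_add_distrib]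

/-- `wsum l · 0` is additive. -/
theorem wsum_add_left (l : List (Fin m → Bool)) (p p' : CubeFn (ZMod 2) m) :
    wsum l (p + p') 0 = wsum l p 0 + wsum l p' 0 := by
  unfold wsum
  have h : ∀ u, DomCert.patZ (p + p') 0 u = DomCert.patZ p 0 u + DomCert.patZ p' 0 u := fun u => by
    unfold DomCert.patZ; split_ifs <;> simp
  rw [Finset.sum_congr rfl fun u _ => h u, sum_add_distrib]

/-- `wsum l 0 ·` is additive. -/
theorem wsum_add_right (l : List (Fin m → Bool)) (q q' : CubeFn (ZMod 2) m) :
    wsum l 0 (q + q') = wsum l 0 q + wsum l 0 q' := by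
  unfold wsum
  have h : ∀ u, DomCert.patZ 0 (q + q') u = DomCert.patZ 0 q u + DomCert.patZ 0 q' u := fun u => by
    unfold DomCert.patZ; split_ifs <;> simp
  rw [Finset.sum_congr rfl fun u _ => h u, sum_add_distrib]

/-- `wsum l (c • p) 0 = c * wsum l p 0`. -/
theorem wsum_smul_left (l : List (Fin m → Bool)) (c : ZMod 2) (p : CubeFn (ZMod 2) m) :
    wsum l (c • p) 0 = c * wsum l p 0 := by
  unfold wsum
  have h : ∀ u, DomCert.patZ (c • p) 0 u = c * DomCert.patZ p 0 u := fun u => by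
    unfold DomCert.patZ; split_ifs <;> simp
  rw [Finset.sum_congr rfl fun u _ => h u, ← mul_sum]

/-- `wsum l 0 (c • q) = c * wsum l 0 q`. -/
theorem wsum_smul_right (l : List (Fin m → Bool)) (c : ZMod 2) (q : CubeFn (ZMod 2) m) :
    wsum l 0 (c • q) = c * wsum l 0 q := by
  unfold wsum
  have h : ∀ u, DomCert.patZ 0 (c • q) u = c * DomCert.patZ 0 q u := fun u => by
    unfold DomCert.patZ; split_ifs <;> simp
  rw [Finset.sum_congr rfl fun u _ => h u, ← mul_sum]

/-- The generator check in `wsum` form. -/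
theorem gens_check {l : List (Fin m → Bool)} (hnd : l.Nodup) (hg : GensOK l) {S : Finset (Fin m)}
    (hS : S.card ≤ 1) : wsum l (mono (ZMod 2) S) 0 = 0 ∧ wsum l 0 (mono (ZMod 2) S) = 0 := by
  unfold wsum
  rw [List.sum_toFinset _ hnd, List.sum_toFinset _ hnd]
  exact hg S (mem_filter.2 ⟨mem_univ _, hS⟩)

/-- A checked word kills every degree-`≤ 1` function on the left … -/
theorem wsum_left_of_lowDeg {l : List (Fin m → Bool)} (hnd : l.Nodup) (hg : GensOK l)
    {p : CubeFn (ZMod 2) m} (hp : p ∈ lowDeg (ZMod 2) m 1) : wsum l p 0 = 0 := by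
  rw [lowDeg_eq_span] at hp
  induction hp using Submodule.span_induction with
  | mem x hx =>
    obtain ⟨⟨S, hS⟩, rfl⟩ := hx
    exact (gens_check hnd hg hS).1
  | zero => unfold wsum DomCert.patZ; simp
  | add x y _ _ hx hy => rw [wsum_add_left, hx, hy, add_zero]
  | smul c x _ hx => rw [wsum_smul_left, hx, mul_zero]

/-- … and on the right. -/
theorem wsum_right_of_lowDeg {l : List (Fin m → Bool)} (hnd : l.Nodup) (hg : GensOK l)
    {q : CubeFn (ZMod 2) m} (hq : q ∈ lowDeg (ZMod 2) m 1) : wsum l 0 q = 0 := by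
  rw [lowDeg_eq_span] at hq
  induction hq using Submodule.span_induction with
  | mem x hx =>
    obtain ⟨⟨S, hS⟩, rfl⟩ := hx
    exact (gens_check hnd hg hS).2
  | zero => unfold wsum DomCert.patZ; simp
  | add x y _ _ hx hy => rw [wsum_add_right, hx, hy, add_zero]
  | smul c x _ hx => rw [wsum_smul_right, hx, mul_zero]

/-- **A checked word has even overlap with every codeword.** -/
theorem sum_indicator_eq_zero {l : List (Fin m → Bool)} (hnd : l.Nodup) (hg : GensOK l)
    {A : (Fin m → Bool) → Bool} (hA : IsElim1 m A) :
    (∑ u ∈ l.toFinset, (if A u = true then (1 : ZMod 2) else 0)) = 0 := by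
  obtain ⟨T, hT, hTe, hTA⟩ := hA
  set p : CubeFn (ZMod 2) m := fun u => if T 0 u = true then 1 else 0 with hp
  set q : CubeFn (ZMod 2) m := fun u => if T 1 u = true then 1 else 0 with hq
  have hpat : ∀ u, (if A u = true then (1 : ZMod 2) else 0) = DomCert.patZ p q u := by
    intro u
    rw [hTA u]
    unfold DomCert.patZ
    have h3 : wt u % 3 < 3 := Nat.mod_lt _ (by norm_num)
    have hev := hTe u
    generalize wt u % 3 = r at h3
    interval_cases r
    · simp [hp]
    · simp [hq]
    · simp only [hp, hq, show (2 : ℕ) = 0 ↔ False from by norm_num, show (2 : ℕ) = 1 ↔ False from by norm_num,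
        if_false]
      revert hev
      cases T 0 u <;> cases T 1 u <;> cases T 2 u <;> decide
  have hrel : wsum l p q = 0 := by
    rw [wsum_split, wsum_left_of_lowDeg hnd hg (hT 0), wsum_right_of_lowDeg hnd hg (hT 1), add_zero]
  unfold wsum at hrel
  rw [Finset.sum_congr rfl fun u _ => hpat u]
  exact hrel

/-- Hence the indicator vector of a checked word is a DUAL word. -/
theorem isDualVec_vec {l : List (Fin m → Bool)} (hnd : l.Nodup) (hg : GensOK l) : IsDualVec m (vec l) := by
  classical
  intro A hA
  have h1 : (∑ u : Fin m → Bool, (if A u = true then vec l u else 0)) =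
      ∑ u ∈ l.toFinset, (if A u = true then (1 : ZMod 2) else 0) := by
    rw [← Finset.sum_subset (Finset.subset_univ l.toFinset)]
    · refine Finset.sum_congr rfl fun u hu => ?_
      rw [vec_of_mem (List.mem_toFinset.1 hu)]
    · intro u _ hu
      rw [vec_of_not_mem (fun h => hu (List.mem_toFinset.2 h))]
      simp
  rw [h1]
  exact sum_indicator_eq_zero hnd hg hA

/-- Its support is the word. -/
theorem suppOut_vec {K0 : (Fin m → Bool) → Bool} {l : List (Fin m → Bool)} (hout : ∀ u ∈ l, K0 u = true) :
    SuppOut K0 (vec l) := by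
  intro u hu
  by_cases h : u ∈ l
  · exact hout u h
  · exact absurd (vec_of_not_mem h) hu

/-- Its support has at most `length` points. -/
theorem card_supp_vec_le (l : List (Fin m → Bool)) :
    (univ.filter fun u : Fin m → Bool => vec l u ≠ 0).card ≤ l.length := by
  classical
  refine le_trans (Finset.card_le_card fun u hu => ?_) (List.toFinset_card_le l)
  rw [mem_filter] at hu
  rw [List.mem_toFinset]
  by_contra h
  exact hu.2 (vec_of_not_mem h)

/-- The set of short outside dual words of `DualGenOut`. -/
def shortSet (m : ℕ) (K0 : (Fin m → Bool) → Bool) (L : ℕ) : Set ((Fin m → Bool) → ZMod 2) :=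
  {r' | IsDualVec m r' ∧ SuppOut K0 r' ∧ (univ.filter fun u : Fin m → Bool => r' u ≠ 0).card ≤ L}

/-- Every certificate word is a short outside dual word. -/
theorem vec_mem_shortSet {K0 : (Fin m → Bool) → Bool} {L : ℕ} {ws : List (List ℕ × ℕ)}
    (h1 : WordsOK K0 L ws) {e : List ℕ × ℕ} (he : e ∈ ws) : vec (pts m e.1) ∈ shortSet m K0 L := by
  obtain ⟨hnd, hlen, hout, _, hg⟩ := h1 e he
  exact ⟨isDualVec_vec hnd hg, suppOut_vec hout, le_trans (card_supp_vec_le _) hlen⟩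

/-! ### The dual words supported outside `Z` form a subspace -/

/-- The subspace of dual words supported outside `Z(K0)`. -/
def dualOut (m : ℕ) (K0 : (Fin m → Bool) → Bool) : Submodule (ZMod 2) ((Fin m → Bool) → ZMod 2) where
  carrier := {r | IsDualVec m r ∧ SuppOut K0 r}
  zero_mem' := ⟨fun A _ => by simp, fun u hu => absurd rfl hu⟩
  add_mem' := by
    rintro r s ⟨hr, hr'⟩ ⟨hs, hs'⟩
    refine ⟨fun A hA => ?_, fun u hu => ?_⟩
    · have h : (∑ u : Fin m → Bool, (if A u = true then (r + s) u else 0)) =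
          (∑ u : Fin m → Bool, (if A u = true then r u else 0)) +
            ∑ u : Fin m → Bool, (if A u = true then s u else 0) := by
        rw [← sum_add_distrib]
        exact Finset.sum_congr rfl fun u _ => by rw [Pi.add_apply]; split_ifs <;> simp
      rw [h, hr A hA, hs A hA, add_zero]
    · rw [Pi.add_apply] at hu
      by_cases h : r u = 0
      · rw [h, zero_add] at hu; exact hs' u hu
      · exact hr' u h
  smul_mem' := by
    rintro c r ⟨hr, hr'⟩
    refine ⟨fun A hA => ?_, fun u hu => ?_⟩
    · have h : (∑ u : Fin m → Bool, (if A u = true then (c • r) u else 0)) =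
          c * ∑ u : Fin m → Bool, (if A u = true then r u else 0) := by
        rw [mul_sum]
        exact Finset.sum_congr rfl fun u _ => by rw [Pi.smul_apply, smul_eq_mul]; split_ifs <;> simp
      rw [h, hr A hA, mul_zero]
    · rw [Pi.smul_apply, smul_eq_mul] at hu
      exact hr' u (right_ne_zero_of_mul hu)

/-- Membership in `dualOut`. -/
theorem mem_dualOut {K0 : (Fin m → Bool) → Bool} {r : (Fin m → Bool) → ZMod 2} :
    r ∈ dualOut m K0 ↔ IsDualVec m r ∧ SuppOut K0 r := Iff.rfl

/-- The short outside dual words span a subspace of `dualOut`. -/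
theorem span_shortSet_le (K0 : (Fin m → Bool) → Bool) (L : ℕ) :
    Submodule.span (ZMod 2) (shortSet m K0 L) ≤ dualOut m K0 :=
  Submodule.span_le.2 fun _ hr => ⟨hr.1, hr.2.1⟩

/-! ### Triangular elimination -/

/-- The vectors of a word list. -/
def vecs (m : ℕ) (ws : List (List ℕ × ℕ)) : Set ((Fin m → Bool) → ZMod 2) :=
  {v | ∃ e ∈ ws, v = vec (pts m e.1)}

/-- Everything in the span of words avoiding a point vanishes there. -/
theorem span_vanish {ws : List (List ℕ × ℕ)} {u : Fin m → Bool} (hu : ∀ e ∈ ws, u ∉ pts m e.1)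
    {v : (Fin m → Bool) → ZMod 2} (hv : v ∈ Submodule.span (ZMod 2) (vecs m ws)) : v u = 0 := by
  induction hv using Submodule.span_induction with
  | mem x hx =>
    obtain ⟨e, he, rfl⟩ := hx
    exact vec_of_not_mem (hu e he)
  | zero => rfl
  | add x y _ _ hx hy => rw [Pi.add_apply, hx, hy, add_zero]
  | smul c x _ hx => rw [Pi.smul_apply, hx, smul_zero]

/-- **Triangular elimination**: along a triangular word list every vector is congruent, modulo the span of
the words, to one vanishing at all pivots. -/
theorem elim {ws : List (List ℕ × ℕ)} (hT : triOK m ws = true) (hpiv : ∀ e ∈ ws, pt m e.2 ∈ pts m e.1)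
    (r : (Fin m → Bool) → ZMod 2) :
    ∃ r₀ ∈ Submodule.span (ZMod 2) (vecs m ws), ∀ e ∈ ws, (r - r₀) (pt m e.2) = 0 := by
  induction ws generalizing r with
  | nil => exact ⟨0, Submodule.zero_mem _, fun e he => by simp at he⟩
  | cons e t ih =>
    simp only [triOK, Bool.and_eq_true, List.all_eq_true, Bool.not_eq_true', decide_eq_false_iff_not] at hT
    obtain ⟨havoid, hTt⟩ := hT
    have hpe : pt m e.2 ∈ pts m e.1 := hpiv e (by simp)
    obtain ⟨r₀', hr₀', hvan⟩ := ih hTt (fun e' he' => hpiv e' (List.mem_cons_of_mem _ he')) (r - r (pt m e.2) • vec (pts m e.1))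
    have hsub : Submodule.span (ZMod 2) (vecs m t) ≤ Submodule.span (ZMod 2) (vecs m (e :: t)) :=
      Submodule.span_mono fun v ⟨e', he', hv⟩ => ⟨e', List.mem_cons_of_mem _ he', hv⟩
    refine ⟨r (pt m e.2) • vec (pts m e.1) + r₀', Submodule.add_mem _ (Submodule.smul_mem _ _
      (Submodule.subset_span ⟨e, by simp, rfl⟩)) (hsub hr₀'), ?_⟩
    intro e' he'
    have hre : r - (r (pt m e.2) • vec (pts m e.1) + r₀') = (r - r (pt m e.2) • vec (pts m e.1)) - r₀' := by
      abel
    rw [hre]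
    rcases List.mem_cons.1 he' with rfl | he'
    · -- the head: its own pivot
      rw [Pi.sub_apply, span_vanish havoid hr₀', sub_zero, Pi.sub_apply, Pi.smul_apply, vec_of_mem hpe,
        smul_eq_mul, mul_one, sub_self]
    · exact hvan e' he'

/-! ### Soundness -/

/-- **Soundness of the certificate.** -/
theorem dualGenOut_of_cert (K0 : (Fin m → Bool) → Bool) (L : ℕ) (ws : List (List ℕ × ℕ))
    (sep : List (ℕ × ℕ × Bool × ℕ × Bool)) (h1 : WordsOK K0 L ws) (h2 : triOK m ws = true)
    (h3 : CoverOK K0 ws sep) (h4 : SepOK m sep) : DualGenOut m K0 L := by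
  classical
  intro r hdual hout
  -- reduce `r` to `r' = r - r₀` vanishing at the pivots
  obtain ⟨r₀, hr₀, hvan⟩ := elim h2 (fun e he => (h1 e he).2.2.2.1) r
  have hsub : Submodule.span (ZMod 2) (vecs m ws) ≤ Submodule.span (ZMod 2) (shortSet m K0 L) :=
    Submodule.span_mono fun v ⟨e, he, hv⟩ => hv ▸ vec_mem_shortSet h1 he
  have hr₀S : r₀ ∈ Submodule.span (ZMod 2) (shortSet m K0 L) := hsub hr₀
  -- `r'` is a dual word supported outside `Z`
  have hr' : r - r₀ ∈ dualOut m K0 :=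
    Submodule.sub_mem _ ⟨hdual, hout⟩ (span_shortSet_le K0 L hr₀S)
  obtain ⟨hdual', hout'⟩ := (mem_dualOut).1 hr'
  -- `r'` vanishes: inside `Z` by support, at pivots by elimination, at non-pivots by separation
  have hzero : ∀ u, (r - r₀) u = 0 := by
    intro u
    by_contra hne
    have hK : K0 u = true := hout' u hne
    rcases h3 u hK with hp | hq
    · obtain ⟨e, he, rfl⟩ := List.mem_map.1 hp
      exact hne (hvan e he)
    · obtain ⟨e, he, rfl⟩ := List.mem_map.1 hq
      -- pair with the separating codeword of `q = pt e.1`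
      have hpair := hdual' (sepWord m e) (SymCount.isElim1_cwOf _ _)
      have hterm : ∀ v : Fin m → Bool, (if sepWord m e v = true then (r - r₀) v else 0) =
          if v = pt m e.1 then (r - r₀) v else 0 := by
        intro v
        by_cases hv0 : (r - r₀) v = 0
        · rw [hv0]; split_ifs <;> rfl
        · -- `v` is a non-pivot outside point
          have hKv : K0 v = true := hout' v hv0
          rcases h3 v hKv with hp' | hq'
          · obtain ⟨e', he', rfl⟩ := List.mem_map.1 hp'
            exact absurd (hvan e' he') hv0
          · obtain ⟨e', he', rfl⟩ := List.mem_map.1 hq'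
            rw [h4 e he e' he']
            by_cases heq : pt m e'.1 = pt m e.1
            · rw [if_pos heq, decide_eq_true heq, if_pos rfl]
            · rw [if_neg heq, decide_eq_false heq]; simp
      rw [Finset.sum_congr rfl fun v _ => hterm v, Finset.sum_ite_eq' univ (pt m e.1)] at hpair
      simp only [mem_univ, if_true] at hpair
      exact hne hpair
  have hr : r = r₀ := by
    funext u; have := hzero u; rw [Pi.sub_apply] at this; exact (sub_eq_zero.1 this)
  rw [hr]
  exact hr₀S

end DualGenCert

end MassInequality

end Summit.QuantumAdvantage.AdviceFreeQNC0
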